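import Summits.QuantumFields.BalabanUV.T4Continuum.Support.NE7CurvedPlaquetteFactorisation
import Summits.QuantumFields.BalabanUV.T4Continuum.Support.NE7CovariantHodgeBond
import Summits.QuantumFields.BalabanUV.T4Continuum.Support.NE7CovariantWeitzenbockTwoForm
import Summits.QuantumFields.BalabanUV.T4Continuum.Support.NE7GradientCurrency
import HarnessLib

/-!
# NE7CurvedRemainderCodifferential — THE CO-DIFFERENTIAL OF THE COVARIANT CURL OF `A = frame W Z` AGAINST THE RELATIVE-PLAQUETTE DATUM: at a unitary small-field
# background `W` (plaquettes within `a`), for `‖Z‖ ≤ ρ` and an a priori covariant-gradient bound `G`,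
# `‖Σ_μ ∇_μ^†(∇_μ A_ν − ∇_ν A_μ)(x)‖ ≤ J_Q + 8d(e^{4ρ} − 1)(G + aρ) + 8d·aρ`, `J_Q` bounding the `W`-co-differential of `(W e^{Z})(∂p)·W(∂p)⁻¹ − 1` — the curved
# twin of the remainder bookkeeping inside lineage #2's (157) `NE7GradientCurrency.norm_fdiff_le_of_plaqDiv`; file 51

Cell `pub-balaban`, rung (B)+1 sub-cell t4, lineage `b2b-balaban-t4-ne7-p1` (CRUX PROVER NE7 #1 = OWNER of row NE7), generation 79; memo
`t4/b2b-balaban-t4-ne7-p1-g79/GRADIENT-LETTER.md` §2.  File F120 (over F119 `NE7CurvedPlaquetteFactorisation` (`siteCurl_eq_relPlaq_sub`, `X₁_eq`–`X₄_eq`, `Ad_plaqRem`,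
`norm_frame_add_cD`), F117 `NE7CovariantHodgeBond` (`cDstar_sub'`, `cD_sub'`, `norm_hol_plaqWord_sub_one_le`), (157) §1 `NE7GradientCurrency.norm_plaqRem_sub_plaqRem_le` (the
four-factor Lipschitz letter in a Banach algebra), `NE7CovariantWeitzenbockTwoForm.cDstar_neg`, `NE3CovariantCalculus` (`cD`, `cDstar`), `AveragingDeficitCovGrad.norm_curlRem_le`).
WHY.  F119 writes the covariant curl of the site-framed field `A = frame W Z` as `Q − Rem − curlRem` (`Q` the relative plaquette deviation of `W e^{Z}` against `W`,
`Rem = e^{X₁}⋯e^{X₄} − 1 − ΣXᵢ` the second-order product remainder, `curlRem` row NE3-R2's `O(a‖Z‖)` holonomy remainder).  The covariant Hodge identity (F117) wants the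
CO-DIFFERENTIAL `Σ_μ ∇_μ^†` of this curl.  Transport commutes with the remainder polynomial (`Ad_plaqRem`), so `∇_μ^† Rem = Rem(Ad_T X(x−e_μ)) − Rem(X(x))` is within
`(e^{4ρ}−1)·Σᵢ‖∇_μ^† Xᵢ‖` by the Lipschitz letter, and each `∇_μ^† Xᵢ` is a covariant difference of `A` (`≤ G`, `≤ 3G`) possibly conjugated by a plaquette
variable (`+ 4aρ`): `Σᵢ ≤ 8G + 8aρ`.  The `curlRem` differences cost `8aρ` per direction.  The a priori `G` is absorbed on the torus in F121 `NE7GradientCurrencyCurved`.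
WHAT ([folklore]; 0 def, 0 sorry).  §1 `∇^†` tools at a unitary background: `norm_cDstar_le`, `cDstar_eq_neg_Ad_cD`, `norm_cDstar_eq`, `cD_add'`, `norm_cD_le`,
**`norm_cDstar_Ad_le`** (`‖∇_μ^†(Ad_P g)‖ ≤ ‖∇_μ^† g‖ + 2a(‖g(x−e_μ)‖ + ‖g(x)‖)` for unitary `P` within `a` of `1`).  §2 **`norm_cDstar_rem_le`** (the displayed remainder
bound `8(e^{4ρ}−1)(G + aρ)` per direction).  §3 **`norm_codiff_siteCurl_le`** (the displayed END).
HONEST FRAMING (page 1): elementary covariant lattice ∕ Banach-algebra analysis of OUR objects at ONE configuration; the datum `J_Q`, the sup `ρ` and the a priori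
`G` are HYPOTHESES; nothing of Bałaban's asserted; no minimiser; `α₁^Z`'s gain NOT yet assembled (F121–F122); NOT ONE-STEP, NOT NE7; spine 0∕9; finite T⁴ rung (B)+1 —
NOT infinite volume, NOT mass gap, NOT `BetaPertH`, NOT Clay.  Continuum YM on T⁴ ⇐ BetaPertH ∧ nine spine estimates (0/9 proved); BetaPertH ⇐ (D1) ∧ (D4) ∧ CAP+tail;
G-an2-4 gates asym, D1 and NE2/3/4.
-/

set_option autoImplicit false

open scoped BigOperators Matrix Matrix.Norms.L2Operator
open NormedSpace Finset

namespace Summit.QuantumFields.BalabanUV.T4Continuum.NE7CurvedRemainderCodifferential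

open Literature.MathematicalPhysics.QuantumFieldTheory.Balaban1983to89
open B7Prop1Explicit B7Prop2Explicit
open T4AveragingDeficitWall (Ad IsUnitaryCfg SmallField vary curlAt)
open T4AveragingDeficitNonAbelian (Ad_mul Ad_sub)
open AveragingDeficitTransport (norm_Ad_of_unitary)
open AveragingDeficitNearIdentity (Ad_one Ad_add Ad_neg norm_Ad_sub_le)
open AveragingDeficitCovGrad (curlRem norm_curlRem_le norm_Ad_inv_sub_le)
open NE3CovariantCalculus (cD cDstar)
open NE3CovariantWeitzenbock (frame norm_frame)
open NE7CovariantWeitzenbockTwoForm (cD_neg cDstar_neg)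
open NE7CovariantHodgeBond (cDstar_sub' cD_sub' norm_hol_plaqWord_sub_one_le)
open NE7CurvedPlaquetteFactorisation (Ad_plaqRem siteCurl_eq_relPlaq_sub X₁_eq X₂_eq X₃_eq X₄_eq norm_frame_add_cD)
open NE7GradientCurrency (norm_plaqRem_sub_plaqRem_le)

noncomputable section

variable {d : ℕ} {n : Type*} [Fintype n] [DecidableEq n]

/-! ## §1 Tools for the adjoint covariant difference at a unitary background -/

/-- `‖∇_μ^† g(x)‖ ≤ ‖g(x−e_μ)‖ + ‖g(x)‖` (unitary transport). [folklore] -/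
theorem norm_cDstar_le {V : Site d → Fin d → (Matrix n n ℂ)ˣ} (hV : IsUnitaryCfg V) (μ : Fin d) (g : Site d → Matrix n n ℂ) (x : Site d) :
    ‖cDstar V μ g x‖ ≤ ‖g (x - e μ)‖ + ‖g x‖ := by
  unfold cDstar
  refine (norm_sub_le _ _).trans ?_
  rw [norm_Ad_of_unitary ((unitaryUnits _).inv_mem (hV _ _))]

/-- `‖∇_μ g(x)‖ ≤ ‖g(x+e_μ)‖ + ‖g(x)‖` (unitary transport). [folklore] -/
theorem norm_cD_le {V : Site d → Fin d → (Matrix n n ℂ)ˣ} (hV : IsUnitaryCfg V) (μ : Fin d) (g : Site d → Matrix n n ℂ) (x : Site d) :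
    ‖cD V μ g x‖ ≤ ‖g (x + e μ)‖ + ‖g x‖ := by
  unfold cD
  refine (norm_sub_le _ _).trans ?_
  rw [norm_Ad_of_unitary (hV _ _)]

/-- `∇_μ^† g(x) = −Ad_{V(x−e_μ,μ)⁻¹}(∇_μ g)(x−e_μ)`. [folklore] -/
theorem cDstar_eq_neg_Ad_cD (V : Site d → Fin d → (Matrix n n ℂ)ˣ) (μ : Fin d) (g : Site d → Matrix n n ℂ) (x : Site d) :
    cDstar V μ g x = -Ad (V (x - e μ) μ)⁻¹ (cD V μ g (x - e μ)) := by
  simp only [cDstar, cD, sub_add_cancel, Ad_sub, ← Ad_mul, inv_mul_cancel, Ad_one]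
  abel

/-- `‖∇_μ^† g(x)‖ = ‖∇_μ g(x−e_μ)‖` (unitary `V`). [folklore] -/
theorem norm_cDstar_eq [Nonempty n] {V : Site d → Fin d → (Matrix n n ℂ)ˣ} (hV : IsUnitaryCfg V) (μ : Fin d) (g : Site d → Matrix n n ℂ) (x : Site d) :
    ‖cDstar V μ g x‖ = ‖cD V μ g (x - e μ)‖ := by
  rw [cDstar_eq_neg_Ad_cD, norm_neg, norm_Ad_of_unitary ((unitaryUnits _).inv_mem (hV _ _))]

/-- `∇_μ (g + h) = ∇_μ g + ∇_μ h`. [folklore] -/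
theorem cD_add' (V : Site d → Fin d → (Matrix n n ℂ)ˣ) (μ : Fin d) (g h : Site d → Matrix n n ℂ) (x : Site d) :
    cD V μ (fun y => g y + h y) x = cD V μ g x + cD V μ h x := by
  simp only [cD, Ad_add]
  abel

/-- **THE ADJOINT DIFFERENCE OF A PLAQUETTE-CONJUGATED FIELD**: for unitary `P(y)` with `‖P(y) − 1‖ ≤ a`,
`‖∇_μ^†(Ad_{P}g)(x)‖ ≤ ‖∇_μ^† g(x)‖ + 2a·(‖g(x−e_μ)‖ + ‖g(x)‖)`. [folklore] -/
theorem norm_cDstar_Ad_le [Nonempty n] {V : Site d → Fin d → (Matrix n n ℂ)ˣ} (hV : IsUnitaryCfg V) {P : Site d → (Matrix n n ℂ)ˣ}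
    (hP : ∀ y, P y ∈ unitaryUnits (Matrix n n ℂ)) {a : ℝ} (hPa : ∀ y, ‖((P y : (Matrix n n ℂ)ˣ) : Matrix n n ℂ) - 1‖ ≤ a)
    (μ : Fin d) (g : Site d → Matrix n n ℂ) (x : Site d) :
    ‖cDstar V μ (fun y => Ad (P y) (g y)) x‖ ≤ ‖cDstar V μ g x‖ + 2 * a * (‖g (x - e μ)‖ + ‖g x‖) := by
  have hid : cDstar V μ (fun y => Ad (P y) (g y)) x
      = Ad (V (x - e μ) μ)⁻¹ (Ad (P (x - e μ)) (g (x - e μ)) - g (x - e μ)) + cDstar V μ g x - (Ad (P x) (g x) - g x) := by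
    simp only [cDstar, Ad_sub]
    abel
  rw [hid]
  have h1 : ‖Ad (V (x - e μ) μ)⁻¹ (Ad (P (x - e μ)) (g (x - e μ)) - g (x - e μ))‖ ≤ 2 * a * ‖g (x - e μ)‖ := by
    rw [norm_Ad_of_unitary ((unitaryUnits _).inv_mem (hV _ _))]
    exact (norm_Ad_sub_le (hP _) _).trans (by gcongr; exact hPa _)
  have h2 : ‖Ad (P x) (g x) - g x‖ ≤ 2 * a * ‖g x‖ := (norm_Ad_sub_le (hP _) _).trans (by gcongr; exact hPa _)
  calc _ ≤ ‖Ad (V (x - e μ) μ)⁻¹ (Ad (P (x - e μ)) (g (x - e μ)) - g (x - e μ)) + cDstar V μ g x‖ + ‖Ad (P x) (g x) - g x‖ := norm_sub_le _ _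
    _ ≤ (2 * a * ‖g (x - e μ)‖ + ‖cDstar V μ g x‖) + 2 * a * ‖g x‖ := add_le_add ((norm_add_le _ _).trans (add_le_add h1 le_rfl)) h2
    _ = ‖cDstar V μ g x‖ + 2 * a * (‖g (x - e μ)‖ + ‖g x‖) := by ring

/-! ## §2 The co-differential of the product remainder -/

/-- **THE REMAINDER'S ADJOINT DIFFERENCE**: at a unitary `W` with `SmallField W a`, `‖Z‖ ≤ ρ`, and an a priori bound `G` on all covariant forward differences of
`A = frame W Z`, for every `x, μ, ν`: `‖∇_μ^† Rem_{μν}(x)‖ ≤ 8(e^{4ρ} − 1)·(G + aρ)`, where `Rem_{μν}(y) = e^{X₁}e^{X₂}e^{X₃}e^{X₄} − 1 − ΣXᵢ` with the four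
exponents written through `A` (F119 §4). [folklore] -/
theorem norm_cDstar_rem_le [Nonempty n] {W : Site d → Fin d → (Matrix n n ℂ)ˣ} (hW : IsUnitaryCfg W) {a : ℝ} (ha : 0 ≤ a) (hWa : SmallField W a)
    (Z : Site d → Fin d → Matrix n n ℂ) {ρ G : ℝ} (hZ : ∀ y κ, ‖Z y κ‖ ≤ ρ)
    (hG : ∀ (y : Site d) (τ κ : Fin d), ‖cD W τ (fun z => frame W Z z κ) y‖ ≤ G) (x : Site d) (μ ν : Fin d) :
    ‖cDstar W μ (fun y =>
        exp (frame W Z y μ) * exp (frame W Z y ν + cD W μ (fun z => frame W Z z ν) y)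
          * exp (-Ad (hol W y (plaqWord μ ν)) (frame W Z y μ + cD W ν (fun z => frame W Z z μ) y))
          * exp (-Ad (hol W y (plaqWord μ ν)) (frame W Z y ν)) - 1
        - (frame W Z y μ + (frame W Z y ν + cD W μ (fun z => frame W Z z ν) y)
            + -Ad (hol W y (plaqWord μ ν)) (frame W Z y μ + cD W ν (fun z => frame W Z z μ) y)
            + -Ad (hol W y (plaqWord μ ν)) (frame W Z y ν))) x‖
      ≤ 8 * (Real.exp (4 * ρ) - 1) * (G + a * ρ) := by
  have hρ0 : 0 ≤ ρ := (norm_nonneg _).trans (hZ x μ)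
  have hG0 : 0 ≤ G := (norm_nonneg _).trans (hG x μ μ)
  have hE : 0 ≤ Real.exp (4 * ρ) - 1 := by have := Real.one_le_exp (by positivity : 0 ≤ 4 * ρ); linarith
  have hPu : ∀ y, hol W y (plaqWord μ ν) ∈ unitaryUnits (Matrix n n ℂ) := fun y => hol_mem_of hW _ _
  have hPa : ∀ y, ‖((hol W y (plaqWord μ ν) : (Matrix n n ℂ)ˣ) : Matrix n n ℂ) - 1‖ ≤ a := fun y => norm_hol_plaqWord_sub_one_le ha hWa y μ ν
  -- the four exponents as site functions and their norms
  set X₁ : Site d → Matrix n n ℂ := fun y => frame W Z y μ with hX₁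
  set X₂ : Site d → Matrix n n ℂ := fun y => frame W Z y ν + cD W μ (fun z => frame W Z z ν) y with hX₂
  set Y₃ : Site d → Matrix n n ℂ := fun y => frame W Z y μ + cD W ν (fun z => frame W Z z μ) y with hY₃
  set X₃ : Site d → Matrix n n ℂ := fun y => -Ad (hol W y (plaqWord μ ν)) (Y₃ y) with hX₃
  set X₄ : Site d → Matrix n n ℂ := fun y => -Ad (hol W y (plaqWord μ ν)) (frame W Z y ν) with hX₄
  have nX₁ : ∀ y, ‖X₁ y‖ ≤ ρ := fun y => by rw [hX₁, norm_frame hW]; exact hZ _ _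
  have nX₂ : ∀ y, ‖X₂ y‖ ≤ ρ := fun y => by rw [hX₂, norm_frame_add_cD hW]; exact hZ _ _
  have nY₃ : ∀ y, ‖Y₃ y‖ ≤ ρ := fun y => by rw [hY₃, norm_frame_add_cD hW]; exact hZ _ _
  have nX₃ : ∀ y, ‖X₃ y‖ ≤ ρ := fun y => by rw [hX₃, norm_neg, norm_Ad_of_unitary (hPu y)]; exact nY₃ y
  have nX₄ : ∀ y, ‖X₄ y‖ ≤ ρ := fun y => by rw [hX₄, norm_neg, norm_Ad_of_unitary (hPu y), norm_frame hW]; exact hZ _ _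
  -- transport commutes with the remainder: the adjoint difference is a difference of two remainders
  set T : (Matrix n n ℂ)ˣ := (W (x - e μ) μ)⁻¹ with hT
  have hTu : T ∈ unitaryUnits (Matrix n n ℂ) := (unitaryUnits _).inv_mem (hW _ _)
  have hcd : cDstar W μ (fun y => exp (X₁ y) * exp (X₂ y) * exp (X₃ y) * exp (X₄ y) - 1 - (X₁ y + X₂ y + X₃ y + X₄ y)) x
      = (exp (Ad T (X₁ (x - e μ))) * exp (Ad T (X₂ (x - e μ))) * exp (Ad T (X₃ (x - e μ))) * exp (Ad T (X₄ (x - e μ))) - 1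
          - (Ad T (X₁ (x - e μ)) + Ad T (X₂ (x - e μ)) + Ad T (X₃ (x - e μ)) + Ad T (X₄ (x - e μ))))
        - (exp (X₁ x) * exp (X₂ x) * exp (X₃ x) * exp (X₄ x) - 1 - (X₁ x + X₂ x + X₃ x + X₄ x)) := by
    show Ad T _ - _ = _
    rw [Ad_plaqRem]
  -- the Lipschitz letter of the four-factor remainder
  have hlip := norm_plaqRem_sub_plaqRem_le (𝔸 := Matrix n n ℂ)
    (by rw [norm_Ad_of_unitary hTu]; exact nX₁ (x - e μ)) (by rw [norm_Ad_of_unitary hTu]; exact nX₂ (x - e μ))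
    (by rw [norm_Ad_of_unitary hTu]; exact nX₃ (x - e μ)) (by rw [norm_Ad_of_unitary hTu]; exact nX₄ (x - e μ))
    (nX₁ x) (nX₂ x) (nX₃ x) (nX₄ x)
  -- the four transported differences are the adjoint differences of the `Xᵢ`
  have hdiff : ∀ Xi : Site d → Matrix n n ℂ, Ad T (Xi (x - e μ)) - Xi x = cDstar W μ Xi x := fun Xi => rfl
  rw [hdiff, hdiff, hdiff, hdiff] at hlip
  -- bounds on the four adjoint differences
  have d₁ : ‖cDstar W μ X₁ x‖ ≤ G := by rw [norm_cDstar_eq hW]; exact hG _ _ _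
  have hcDcD : ∀ (τ κ : Fin d) (y : Site d), ‖cD W μ (cD W τ (fun z => frame W Z z κ)) y‖ ≤ 2 * G := fun τ κ y =>
    (norm_cD_le hW μ _ y).trans (by linarith [hG (y + e μ) τ κ, hG y τ κ])
  have d₂ : ‖cDstar W μ X₂ x‖ ≤ 3 * G := by
    rw [norm_cDstar_eq hW, hX₂, cD_add']
    exact (norm_add_le _ _).trans (by linarith [hG (x - e μ) μ ν, hcDcD μ ν (x - e μ)])
  have dY₃ : ‖cDstar W μ Y₃ x‖ ≤ 3 * G := by
    rw [norm_cDstar_eq hW, hY₃, cD_add']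
    exact (norm_add_le _ _).trans (by linarith [hG (x - e μ) μ μ, hcDcD ν μ (x - e μ)])
  have d₃ : ‖cDstar W μ X₃ x‖ ≤ 3 * G + 4 * a * ρ := by
    rw [hX₃, cDstar_neg, norm_neg]
    refine (norm_cDstar_Ad_le hW hPu hPa μ Y₃ x).trans ?_
    nlinarith [dY₃, nY₃ (x - e μ), nY₃ x, ha]
  have d₄ : ‖cDstar W μ X₄ x‖ ≤ G + 4 * a * ρ := by
    rw [hX₄, cDstar_neg, norm_neg]
    refine (norm_cDstar_Ad_le hW hPu hPa μ (fun y => frame W Z y ν) x).trans ?_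
    have h1 : ‖cDstar W μ (fun y => frame W Z y ν) x‖ ≤ G := by rw [norm_cDstar_eq hW]; exact hG _ _ _
    have h2 : ‖frame W Z (x - e μ) ν‖ ≤ ρ := by rw [norm_frame hW]; exact hZ _ _
    have h3 : ‖frame W Z x ν‖ ≤ ρ := by rw [norm_frame hW]; exact hZ _ _
    nlinarith [h1, h2, h3, ha]
  -- assemble
  have hsum : ‖cDstar W μ X₁ x‖ + ‖cDstar W μ X₂ x‖ + ‖cDstar W μ X₃ x‖ + ‖cDstar W μ X₄ x‖ ≤ 8 * (G + a * ρ) := by linarith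
  show ‖cDstar W μ (fun y => exp (X₁ y) * exp (X₂ y) * exp (X₃ y) * exp (X₄ y) - 1 - (X₁ y + X₂ y + X₃ y + X₄ y)) x‖ ≤ _
  rw [hcd]
  refine hlip.trans ?_
  calc (Real.exp (4 * ρ) - 1) * (‖cDstar W μ X₁ x‖ + ‖cDstar W μ X₂ x‖ + ‖cDstar W μ X₃ x‖ + ‖cDstar W μ X₄ x‖)
      ≤ (Real.exp (4 * ρ) - 1) * (8 * (G + a * ρ)) := mul_le_mul_of_nonneg_left hsum hE
    _ = 8 * (Real.exp (4 * ρ) - 1) * (G + a * ρ) := by ring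

/-! ## §3 THE END: the co-differential of the covariant curl against the relative-plaquette datum -/

/-- **THE CO-DIFFERENTIAL OF THE COVARIANT CURL OF `A = frame W Z`** (unitary `W` with `SmallField W a`, `‖Z‖ ≤ ρ`, a priori covariant-gradient bound `G`): if the
`W`-co-differential of the relative plaquette deviation obeys `‖Σ_μ ∇_μ^†[(W e^{Z})(∂p_{μν})·W(∂p_{μν})⁻¹ − 1](x)‖ ≤ J`, then
`‖Σ_μ ∇_μ^†(∇_μ A_ν − ∇_ν A_μ)(x)‖ ≤ J + 8d(e^{4ρ} − 1)(G + aρ) + 8d·aρ`. [folklore] -/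
theorem norm_codiff_siteCurl_le [Nonempty n] {W : Site d → Fin d → (Matrix n n ℂ)ˣ} (hW : IsUnitaryCfg W) {a : ℝ} (ha : 0 ≤ a) (hWa : SmallField W a)
    (Z : Site d → Fin d → Matrix n n ℂ) {ρ G : ℝ} (hZ : ∀ y κ, ‖Z y κ‖ ≤ ρ)
    (hG : ∀ (y : Site d) (τ κ : Fin d), ‖cD W τ (fun z => frame W Z z κ) y‖ ≤ G) (x : Site d) (ν : Fin d) {J : ℝ}
    (hJ : ‖∑ μ, cDstar W μ (fun y => ((hol (vary W Z 1) y (plaqWord μ ν) : (Matrix n n ℂ)ˣ) : Matrix n n ℂ)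
        * (((hol W y (plaqWord μ ν))⁻¹ : (Matrix n n ℂ)ˣ) : Matrix n n ℂ) - 1) x‖ ≤ J) :
    ‖∑ μ, cDstar W μ (fun y => cD W μ (fun z => frame W Z z ν) y - cD W ν (fun z => frame W Z z μ) y) x‖
      ≤ J + 8 * d * (Real.exp (4 * ρ) - 1) * (G + a * ρ) + 8 * d * (a * ρ) := by
  have hρ0 : 0 ≤ ρ := (norm_nonneg _).trans (hZ x ν)
  -- the curl as datum minus the two remainders, under the co-differential
  have hsplit : ∀ μ : Fin d,
      cDstar W μ (fun y => cD W μ (fun z => frame W Z z ν) y - cD W ν (fun z => frame W Z z μ) y) x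
        = cDstar W μ (fun y => ((hol (vary W Z 1) y (plaqWord μ ν) : (Matrix n n ℂ)ˣ) : Matrix n n ℂ)
              * (((hol W y (plaqWord μ ν))⁻¹ : (Matrix n n ℂ)ˣ) : Matrix n n ℂ) - 1) x
          - cDstar W μ (fun y =>
              exp (frame W Z y μ) * exp (frame W Z y ν + cD W μ (fun z => frame W Z z ν) y)
                * exp (-Ad (hol W y (plaqWord μ ν)) (frame W Z y μ + cD W ν (fun z => frame W Z z μ) y))
                * exp (-Ad (hol W y (plaqWord μ ν)) (frame W Z y ν)) - 1
              - (frame W Z y μ + (frame W Z y ν + cD W μ (fun z => frame W Z z ν) y)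
                  + -Ad (hol W y (plaqWord μ ν)) (frame W Z y μ + cD W ν (fun z => frame W Z z μ) y)
                  + -Ad (hol W y (plaqWord μ ν)) (frame W Z y ν))) x
          - cDstar W μ (fun y => curlRem W Z y μ ν) x := by
    intro μ
    rw [← cDstar_sub', ← cDstar_sub']
    congr 1
    funext y
    rw [siteCurl_eq_relPlaq_sub, X₁_eq, X₂_eq, X₃_eq, X₄_eq]
  simp_rw [hsplit]
  rw [Finset.sum_sub_distrib, Finset.sum_sub_distrib]
  have hrem : ‖∑ μ, cDstar W μ (fun y =>
        exp (frame W Z y μ) * exp (frame W Z y ν + cD W μ (fun z => frame W Z z ν) y)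
          * exp (-Ad (hol W y (plaqWord μ ν)) (frame W Z y μ + cD W ν (fun z => frame W Z z μ) y))
          * exp (-Ad (hol W y (plaqWord μ ν)) (frame W Z y ν)) - 1
        - (frame W Z y μ + (frame W Z y ν + cD W μ (fun z => frame W Z z ν) y)
            + -Ad (hol W y (plaqWord μ ν)) (frame W Z y μ + cD W ν (fun z => frame W Z z μ) y)
            + -Ad (hol W y (plaqWord μ ν)) (frame W Z y ν))) x‖ ≤ 8 * d * (Real.exp (4 * ρ) - 1) * (G + a * ρ) := by
    refine (norm_sum_le _ _).trans ?_
    calc _ ≤ ∑ _μ : Fin d, 8 * (Real.exp (4 * ρ) - 1) * (G + a * ρ) := Finset.sum_le_sum fun μ _ => norm_cDstar_rem_le hW ha hWa Z hZ hG x μ ν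
      _ = 8 * d * (Real.exp (4 * ρ) - 1) * (G + a * ρ) := by rw [Finset.sum_const, Finset.card_univ, Fintype.card_fin, nsmul_eq_mul]; ring
  have hcr : ‖∑ μ, cDstar W μ (fun y => curlRem W Z y μ ν) x‖ ≤ 8 * d * (a * ρ) := by
    refine (norm_sum_le _ _).trans ?_
    have hterm : ∀ μ : Fin d, ‖cDstar W μ (fun y => curlRem W Z y μ ν) x‖ ≤ 8 * (a * ρ) := by
      intro μ
      refine (norm_cDstar_le hW μ _ x).trans ?_
      have h1 := norm_curlRem_le hW Z (x - e μ) (norm_hol_plaqWord_sub_one_le ha hWa (x - e μ) μ ν)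
      have h2 := norm_curlRem_le hW Z x (norm_hol_plaqWord_sub_one_le ha hWa x μ ν)
      nlinarith [hZ (x - e μ + e ν) μ, hZ (x - e μ) ν, hZ (x + e ν) μ, hZ x ν, ha]
    calc _ ≤ ∑ _μ : Fin d, 8 * (a * ρ) := Finset.sum_le_sum fun μ _ => hterm μ
      _ = 8 * d * (a * ρ) := by rw [Finset.sum_const, Finset.card_univ, Fintype.card_fin, nsmul_eq_mul]; ring
  calc _ ≤ ‖∑ μ, cDstar W μ (fun y => ((hol (vary W Z 1) y (plaqWord μ ν) : (Matrix n n ℂ)ˣ) : Matrix n n ℂ)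
              * (((hol W y (plaqWord μ ν))⁻¹ : (Matrix n n ℂ)ˣ) : Matrix n n ℂ) - 1) x
            - ∑ μ, cDstar W μ (fun y =>
              exp (frame W Z y μ) * exp (frame W Z y ν + cD W μ (fun z => frame W Z z ν) y)
                * exp (-Ad (hol W y (plaqWord μ ν)) (frame W Z y μ + cD W ν (fun z => frame W Z z μ) y))
                * exp (-Ad (hol W y (plaqWord μ ν)) (frame W Z y ν)) - 1
              - (frame W Z y μ + (frame W Z y ν + cD W μ (fun z => frame W Z z ν) y)
                  + -Ad (hol W y (plaqWord μ ν)) (frame W Z y μ + cD W ν (fun z => frame W Z z μ) y)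
                  + -Ad (hol W y (plaqWord μ ν)) (frame W Z y ν))) x‖
          + ‖∑ μ, cDstar W μ (fun y => curlRem W Z y μ ν) x‖ := norm_sub_le _ _
    _ ≤ (J + 8 * d * (Real.exp (4 * ρ) - 1) * (G + a * ρ)) + 8 * d * (a * ρ) :=
        add_le_add ((norm_sub_le _ _).trans (add_le_add hJ hrem)) hcr

end

end Summit.QuantumFields.BalabanUV.T4Continuum.NE7CurvedRemainderCodifferential
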